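import Summits.BirchSwinnertonDyer.BirchSwinnertonDyer.Theorems.ByReductionTypeAtTwoOrdEisensteinHalfLowerBounds
import HarnessLib

/-!
# The Eisenstein half of the `2`-adic main conjecture in `Ш`-currency, I: the root mass in `Λ = ℤ_p⟦T⟧`
# (route ByReductionTypeAtTwo / TwoAdicConverse, crux `OrdEisensteinHalfAtTwo`,
# item stmt-BirchSwinnertonDyer-19272; seat bsd-2adic-ord-3, GEN 2)

HONEST FRAMING (cell `bsd-2adic`, run/shared/lean/pub/bsd-2adic/, HUMAN RULINGS D-0036/D-0074): THEOREMS
ONLY — no definition, no named fact, nothing asserted, closes nothing. The crux `OrdEisensteinHalfAtTwo`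
(the Skinner–Urban direction `char_Λ X(E/ℚ_∞) ⊆ (ϖ·L₂(E))` of the cyclotomic main conjecture at `2` for
every non-CM curve good ordinary at `2`) is NOT proved here and is not in print at `p = 2`.

WHY THIS FILE. The tree reads the crux as Greenberg–Vatsal's pair of inequalities
`λ(L₀) ≤ λ(X)`, `μ(L₀) ≤ μ(X)` (`EisensteinLowerBounds.dvd_iff_lam_le_and_mu_le`,
`…Equivalence.lean`), and the seat's GEN 0 census found the `λ`-inequality out of reach of every
FINITE-LAYER rank certificate on the 528 open good-ordinary X5 classes («transcendental zero pairs»).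
This file supplies the pure `Λ`-algebra that ELIMINATES `λ` in favour of the constant term: for
`g ∈ Λ = ℤ_p⟦T⟧` with `g(0) ≠ 0` put `s(g) := ord_p g(0) − μ(g) = ord_p (pfree g)(0)` — the «root
mass» (by Weierstrass preparation, the sum of the valuations of the `λ(g)` roots of the distinguished
polynomial of `g`; here handled through `pfree`, `mu`, `lam` of `X1/MuLambdaAlgebra.lean`, no
Weierstrass preparation invoked). For a RATIONAL divisibility `f·a = pⁿ·L` with `L(0) ≠ 0` (the shape
of Kato's Thm. 17.4 (2) pulled back to `Λ`):

* `s(f) + s(a) = s(L)`, hence `ord_p f(0) − μ(f) ≤ ord_p L(0) − μ(L)` (`valuation_constantCoeff_add_mu_le`);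
* `λ(f) = λ(L) ⟺ ord_p L(0) − μ(L) ≤ ord_p f(0) − μ(f)` (`lam_eq_lam_iff_valuation_le`): the
  `λ`-EQUALITY is a CONSTANT-TERM inequality (`λ(a) = 0 ⟺ (pfree a)(0)` is a unit);
* `L ∣ f ⟺ μ(L) ≤ μ(f) ∧ ord_p L(0) − μ(L) ≤ ord_p f(0) − μ(f)` (`dvd_iff_mu_le_and_valuation_le`);
* `(f) = (L) ⟺ μ(f) = μ(L) ∧ ord_p f(0) = ord_p L(0) ⟺ μ(f) ≤ μ(L) ∧ ord_p L(0) ≤ ord_p f(0)`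
  (`span_eq_span_iff_mu_eq_and_valuation_eq`, `span_eq_span_iff_mu_le_and_valuation_le`).

The sequel files (`…ShaDictionary.lean`, `…ShaCurrency.lean`, `…ShaCrux.lean`) read these at `p = 2`
through Greenberg's Thm. 4.1: `ord₂ f_X(0) − ord₂ L₀(0) = ord₂ #Ш − ord₂ #Ш_an`, so that the Eisenstein
half at a rank-`0` datum becomes an inequality between `#Ш(E)[2^∞]`, `#Ш_an(E)`, `μ(X)` and `μ(L₀)` —
on the `μ = 0` locus exactly the descent inequality `MissingLowerBoundAt W 2`.

References: L. Washington, *Introduction to Cyclotomic Fields*, §7.1 (Weierstrass preparation);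
R. Greenberg, V. Vatsal, Invent. Math. 142 (2000), p. 4; K. Kato, Astérisque 295 (2004), Thm. 17.4.
-/

set_option autoImplicit false

noncomputable section

open scoped Classical MatrixGroups ModularForm

open CongruenceSubgroup WeierstrassCurve Literature.NumberTheory.EllipticCurves
  Literature.NumberTheory.EllipticCurves.ModularForms Literature.NumberTheory.EllipticCurves.Rank1Residual
  Literature.NumberTheory.EllipticCurves.Rank1Residual.Typed
  Summit.BirchSwinnertonDyer.Rank1Residual.X1.MuLambda
  Summit.BirchSwinnertonDyer.Rank1Residual.X1.MuPart
  Summit.BirchSwinnertonDyer.Rank1Residual.X1.ParitySqueeze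

namespace Summit.BirchSwinnertonDyer.BirchSwinnertonDyer.Theorems.EisensteinShaCurrency

/-! ## §1 Pure `Λ`-algebra: the root mass `ord_p g(0) − μ(g)` -/

section Algebra

variable {p : ℕ} [Fact p.Prime]

/-- `g(0) = p^{μ(g)} · (pfree g)(0)`. [folklore] -/
theorem constantCoeff_eq_pow_mu_mul (g : IwasawaAlgebra p) :
    PowerSeries.constantCoeff g = (p : ℤ_[p]) ^ mu g * PowerSeries.constantCoeff (pfree g) := by
  conv_lhs => rw [eq_C_pow_mu_mul_pfree g]
  rw [map_mul, PowerSeries.constantCoeff_C]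

/-- If `g(0) ≠ 0` then `(pfree g)(0) ≠ 0`. [folklore] -/
theorem constantCoeff_pfree_ne_zero {g : IwasawaAlgebra p} (h0 : PowerSeries.constantCoeff g ≠ 0) :
    PowerSeries.constantCoeff (pfree g) ≠ 0 := by
  intro h
  apply h0
  rw [constantCoeff_eq_pow_mu_mul, h, mul_zero]

/-- If `g(0) ≠ 0` then `g ≠ 0`. [folklore] -/
theorem ne_zero_of_constantCoeff_ne_zero {g : IwasawaAlgebra p}
    (h0 : PowerSeries.constantCoeff g ≠ 0) : g ≠ 0 := by
  rintro rfl
  exact h0 (map_zero _)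

/-- **`ord_p g(0) = μ(g) + ord_p (pfree g)(0)`** for `g(0) ≠ 0`. [folklore] -/
theorem valuation_constantCoeff_eq_mu_add {g : IwasawaAlgebra p}
    (h0 : PowerSeries.constantCoeff g ≠ 0) :
    (PowerSeries.constantCoeff g).valuation =
      mu g + (PowerSeries.constantCoeff (pfree g)).valuation := by
  rw [constantCoeff_eq_pow_mu_mul g]
  exact PadicInt.valuation_p_pow_mul _ _ (constantCoeff_pfree_ne_zero h0)

/-- In particular `μ(g) ≤ ord_p g(0)` for `g(0) ≠ 0`. [folklore] -/
theorem mu_le_valuation_constantCoeff {g : IwasawaAlgebra p}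
    (h0 : PowerSeries.constantCoeff g ≠ 0) : mu g ≤ (PowerSeries.constantCoeff g).valuation := by
  rw [valuation_constantCoeff_eq_mu_add h0]
  exact Nat.le_add_right _ _

/-- A nonzero `p`-adic integer is a unit iff its valuation vanishes. [folklore] -/
theorem isUnit_iff_valuation_eq_zero {x : ℤ_[p]} (hx : x ≠ 0) : IsUnit x ↔ x.valuation = 0 := by
  have h1 : ¬ IsUnit x ↔ 1 ≤ x.valuation := by
    rw [PadicInt.not_isUnit_iff, PadicInt.norm_lt_one_iff_dvd,
      ← PadicInt.mem_span_pow_iff_le_valuation x hx 1, pow_one, Ideal.mem_span_singleton]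
  constructor
  · intro hu
    by_contra hne
    exact (h1.mpr (Nat.one_le_iff_ne_zero.mpr hne)) hu
  · intro hv
    by_contra hnu
    have := h1.mp hnu
    omega

/-- **`λ(g) = 0` iff the `p`-free constant term is a unit**, i.e. `ord_p (pfree g)(0) = 0`
(for `g(0) ≠ 0`). By Weierstrass preparation `(pfree g)(0)` is, up to a unit, the product of the
`λ(g)` roots of the distinguished polynomial of `g`, each of positive valuation; this lemma is the
elementary shadow `λ = 0 ⟺ unit constant term`. [cite: Washington1997, §7.1 (Weierstrass preparation)] -/
theorem lam_eq_zero_iff_valuation_constantCoeff_pfree_eq_zero {g : IwasawaAlgebra p}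
    (h0 : PowerSeries.constantCoeff g ≠ 0) :
    lam g = 0 ↔ (PowerSeries.constantCoeff (pfree g)).valuation = 0 := by
  have hg : g ≠ 0 := ne_zero_of_constantCoeff_ne_zero h0
  have hpf0 : PowerSeries.constantCoeff (pfree g) ≠ 0 := constantCoeff_pfree_ne_zero h0
  have hredne : red (pfree g) ≠ 0 := red_pfree_ne_zero hg
  have hfin : (red (pfree g)).order ≠ ⊤ := (PowerSeries.order_finite_iff_ne_zero.mpr hredne).ne
  -- `λ(g) = 0 ⟺ order (red (pfree g)) = 0 ⟺ coeff 0 ≠ 0 ⟺ (pfree g)(0) ∉ 𝔪 ⟺ unit ⟺ valuation 0`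
  have hlam : lam g = 0 ↔ PowerSeries.coeff 0 (red (pfree g)) ≠ 0 := by
    rw [lam, ENat.toNat_eq_zero, or_iff_left hfin]
    constructor
    · intro hord
      have := PowerSeries.coeff_order hredne
      rwa [hord] at this
    · intro hc
      exact nonpos_iff_eq_zero.mp (by simpa using PowerSeries.order_le (φ := red (pfree g)) 0 hc)
  rw [hlam, PowerSeries.coeff_map, PowerSeries.coeff_zero_eq_constantCoeff_apply, Ne,
    IsLocalRing.residue_eq_zero_iff, IsLocalRing.mem_maximalIdeal, mem_nonunits_iff, not_not,
    isUnit_iff_valuation_eq_zero hpf0]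

/-- **`λ(g) = 0 ⟺ ord_p g(0) = μ(g)`** (for `g(0) ≠ 0`); the direction `⇒` is the tree's
`valuation_constantCoeff_of_lam_eq_zero`. [cite: Washington1997, §7.1 (Weierstrass preparation)] -/
theorem lam_eq_zero_iff_valuation_constantCoeff_eq_mu {g : IwasawaAlgebra p}
    (h0 : PowerSeries.constantCoeff g ≠ 0) :
    lam g = 0 ↔ (PowerSeries.constantCoeff g).valuation = mu g := by
  rw [lam_eq_zero_iff_valuation_constantCoeff_pfree_eq_zero h0, valuation_constantCoeff_eq_mu_add h0]
  omega

/-- `μ` and `pfree` of `p^n · L`: `μ(p^n·L) = n + μ(L)`, `pfree(p^n·L) = pfree L` (`L ≠ 0`). [folklore] -/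
theorem mu_and_pfree_C_pow_mul {L : IwasawaAlgebra p} (hL : L ≠ 0) (n : ℕ) :
    mu (PowerSeries.C ((p : ℤ_[p]) ^ n) * L) = n + mu L ∧
      pfree (PowerSeries.C ((p : ℤ_[p]) ^ n) * L) = pfree L := by
  refine mu_eq_and_pfree_eq (red_pfree_ne_zero hL) ?_
  conv_lhs => rw [eq_C_pow_mu_mul_pfree L]
  rw [pow_add, map_mul, mul_assoc]

/-! ### The rational divisibility `f · a = p^n · L` with `L(0) ≠ 0` -/

/-- Constant terms: `f(0)·a(0) = p^n·L(0)`. [folklore] -/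
theorem constantCoeff_mul_eq_of_mul_eq_C_pow_mul {f a L : IwasawaAlgebra p} {n : ℕ}
    (h : f * a = PowerSeries.C ((p : ℤ_[p]) ^ n) * L) :
    PowerSeries.constantCoeff f * PowerSeries.constantCoeff a =
      (p : ℤ_[p]) ^ n * PowerSeries.constantCoeff L := by
  have := congrArg PowerSeries.constantCoeff h
  rwa [map_mul, map_mul, PowerSeries.constantCoeff_C] at this

/-- Non-vanishing bookkeeping: `L(0) ≠ 0` forces `f(0), a(0) ≠ 0` (hence `f, a, L ≠ 0`). [folklore] -/
theorem constantCoeff_ne_zero_of_mul_eq_C_pow_mul {f a L : IwasawaAlgebra p} {n : ℕ}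
    (h : f * a = PowerSeries.C ((p : ℤ_[p]) ^ n) * L) (hL0 : PowerSeries.constantCoeff L ≠ 0) :
    PowerSeries.constantCoeff f ≠ 0 ∧ PowerSeries.constantCoeff a ≠ 0 := by
  have hprod : PowerSeries.constantCoeff f * PowerSeries.constantCoeff a ≠ 0 := by
    rw [constantCoeff_mul_eq_of_mul_eq_C_pow_mul h]
    exact mul_ne_zero (pow_ne_zero _ (by exact_mod_cast (Fact.out : p.Prime).ne_zero)) hL0
  exact ⟨left_ne_zero_of_mul hprod, right_ne_zero_of_mul hprod⟩

/-- The `p`-free parts multiply: `pfree f · pfree a = pfree L`. [folklore] -/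
theorem pfree_mul_pfree_eq_of_mul_eq_C_pow_mul {f a L : IwasawaAlgebra p} {n : ℕ}
    (h : f * a = PowerSeries.C ((p : ℤ_[p]) ^ n) * L) (hL0 : PowerSeries.constantCoeff L ≠ 0) :
    pfree f * pfree a = pfree L := by
  obtain ⟨hf0, ha0⟩ := constantCoeff_ne_zero_of_mul_eq_C_pow_mul h hL0
  rw [← pfree_mul (ne_zero_of_constantCoeff_ne_zero hf0) (ne_zero_of_constantCoeff_ne_zero ha0), h,
    (mu_and_pfree_C_pow_mul (ne_zero_of_constantCoeff_ne_zero hL0) n).2]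

/-- **Root masses add**: `ord_p (pfree f)(0) + ord_p (pfree a)(0) = ord_p (pfree L)(0)`. In
Weierstrass terms: the distinguished polynomial of `f` divides that of `p^n·L`, and the constant
term of a distinguished polynomial is (±) the product of its roots. [cite: Washington1997, §7.1] -/
theorem valuation_constantCoeff_pfree_add {f a L : IwasawaAlgebra p} {n : ℕ}
    (h : f * a = PowerSeries.C ((p : ℤ_[p]) ^ n) * L) (hL0 : PowerSeries.constantCoeff L ≠ 0) :
    (PowerSeries.constantCoeff (pfree f)).valuation + (PowerSeries.constantCoeff (pfree a)).valuation =
      (PowerSeries.constantCoeff (pfree L)).valuation := by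
  obtain ⟨hf0, ha0⟩ := constantCoeff_ne_zero_of_mul_eq_C_pow_mul h hL0
  have e := congrArg PowerSeries.constantCoeff (pfree_mul_pfree_eq_of_mul_eq_C_pow_mul h hL0)
  rw [map_mul] at e
  rw [← PadicInt.valuation_mul (constantCoeff_pfree_ne_zero hf0) (constantCoeff_pfree_ne_zero ha0), e]

/-- **Kato's direction read on the constant term, with the `μ`-defect (pure algebra).** From
`f·a = p^n·L`, `L(0) ≠ 0`: `ord_p f(0) − μ(f) ≤ ord_p L(0) − μ(L)`, written additively.
[cite: Washington1997, §7.1 (Weierstrass preparation)] -/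
theorem valuation_constantCoeff_add_mu_le {f a L : IwasawaAlgebra p} {n : ℕ}
    (h : f * a = PowerSeries.C ((p : ℤ_[p]) ^ n) * L) (hL0 : PowerSeries.constantCoeff L ≠ 0) :
    (PowerSeries.constantCoeff f).valuation + mu L ≤ (PowerSeries.constantCoeff L).valuation + mu f := by
  obtain ⟨hf0, -⟩ := constantCoeff_ne_zero_of_mul_eq_C_pow_mul h hL0
  have hadd := valuation_constantCoeff_pfree_add h hL0
  rw [valuation_constantCoeff_eq_mu_add hf0, valuation_constantCoeff_eq_mu_add hL0]
  omega

/-- `λ(f) + λ(a) = λ(L)`. [folklore] -/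
theorem lam_add_lam_eq_of_mul_eq_C_pow_mul {f a L : IwasawaAlgebra p} {n : ℕ}
    (h : f * a = PowerSeries.C ((p : ℤ_[p]) ^ n) * L) (hL0 : PowerSeries.constantCoeff L ≠ 0) :
    lam f + lam a = lam L := by
  obtain ⟨hf0, ha0⟩ := constantCoeff_ne_zero_of_mul_eq_C_pow_mul h hL0
  rw [← lam_mul (ne_zero_of_constantCoeff_ne_zero hf0) (ne_zero_of_constantCoeff_ne_zero ha0), h,
    lam_C_pow_mul n (ne_zero_of_constantCoeff_ne_zero hL0)]

/-- Kato's direction: `λ(f) ≤ λ(L)`. [folklore] -/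
theorem lam_le_of_mul_eq_C_pow_mul {f a L : IwasawaAlgebra p} {n : ℕ}
    (h : f * a = PowerSeries.C ((p : ℤ_[p]) ^ n) * L) (hL0 : PowerSeries.constantCoeff L ≠ 0) :
    lam f ≤ lam L := by
  have := lam_add_lam_eq_of_mul_eq_C_pow_mul h hL0
  omega

/-- **THE `λ`-EQUALITY IS A CONSTANT-TERM INEQUALITY.** From `f·a = p^n·L`, `L(0) ≠ 0`:
`λ(f) = λ(L) ⟺ ord_p L(0) − μ(L) ≤ ord_p f(0) − μ(f)` (written additively). Proof: `λ(f) = λ(L)` iff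
`λ(a) = 0` iff `(pfree a)(0)` is a unit iff the root masses of `f` and `L` agree.
[cite: Washington1997, §7.1 (Weierstrass preparation)] [cite: GreenbergVatsal2000, p. 4 (after Thm. (1.2))] -/
theorem lam_eq_lam_iff_valuation_le {f a L : IwasawaAlgebra p} {n : ℕ}
    (h : f * a = PowerSeries.C ((p : ℤ_[p]) ^ n) * L) (hL0 : PowerSeries.constantCoeff L ≠ 0) :
    lam f = lam L ↔
      (PowerSeries.constantCoeff L).valuation + mu f ≤ (PowerSeries.constantCoeff f).valuation + mu L := by
  obtain ⟨hf0, ha0⟩ := constantCoeff_ne_zero_of_mul_eq_C_pow_mul h hL0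
  have hlam := lam_add_lam_eq_of_mul_eq_C_pow_mul h hL0
  have hadd := valuation_constantCoeff_pfree_add h hL0
  have hvf := valuation_constantCoeff_eq_mu_add hf0
  have hvL := valuation_constantCoeff_eq_mu_add hL0
  have ha := lam_eq_zero_iff_valuation_constantCoeff_pfree_eq_zero ha0
  constructor
  · intro he
    have hla : lam a = 0 := by omega
    have := ha.mp hla
    omega
  · intro hle
    have : (PowerSeries.constantCoeff (pfree a)).valuation = 0 := by omega
    have hla := ha.mpr this
    omega

/-- **`L ∣ f` ⟺ `μ(L) ≤ μ(f)` and `ord_p L(0) − μ(L) ≤ ord_p f(0) − μ(f)`** (from `f·a = p^n·L`,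
`L(0) ≠ 0`): the tree's `dvd_iff_lam_le_and_mu_le` with the `λ`-inequality traded for the
constant-term inequality. [cite: GreenbergVatsal2000, p. 4 (after Thm. (1.2))] -/
theorem dvd_iff_mu_le_and_valuation_le {f a L : IwasawaAlgebra p} {n : ℕ}
    (h : f * a = PowerSeries.C ((p : ℤ_[p]) ^ n) * L) (hL0 : PowerSeries.constantCoeff L ≠ 0) :
    L ∣ f ↔ mu L ≤ mu f ∧
      (PowerSeries.constantCoeff L).valuation + mu f ≤ (PowerSeries.constantCoeff f).valuation + mu L := by
  obtain ⟨hf0, -⟩ := constantCoeff_ne_zero_of_mul_eq_C_pow_mul h hL0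
  have hle := lam_le_of_mul_eq_C_pow_mul h hL0
  rw [EisensteinLowerBounds.dvd_iff_lam_le_and_mu_le (ne_zero_of_constantCoeff_ne_zero hf0)
    (ne_zero_of_constantCoeff_ne_zero hL0) (C_pow_ne_zero n) (lam_C_pow n)
    ((mul_comm a f).trans h), ← lam_eq_lam_iff_valuation_le h hL0]
  constructor
  · rintro ⟨hl, hm⟩; exact ⟨hm, le_antisymm hle hl⟩
  · rintro ⟨hm, he⟩; exact ⟨he.ge, hm⟩

/-- **`(f) = (L)` ⟺ `μ(f) = μ(L)` and `ord_p f(0) = ord_p L(0)`** (from `f·a = p^n·L`, `L(0) ≠ 0`).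
[cite: GreenbergVatsal2000, p. 4 (after Thm. (1.2))] [cite: Washington1997, §7.1] -/
theorem span_eq_span_iff_mu_eq_and_valuation_eq {f a L : IwasawaAlgebra p} {n : ℕ}
    (h : f * a = PowerSeries.C ((p : ℤ_[p]) ^ n) * L) (hL0 : PowerSeries.constantCoeff L ≠ 0) :
    Ideal.span ({f} : Set (IwasawaAlgebra p)) = Ideal.span {L} ↔
      mu f = mu L ∧ (PowerSeries.constantCoeff f).valuation = (PowerSeries.constantCoeff L).valuation := by
  obtain ⟨hf0, -⟩ := constantCoeff_ne_zero_of_mul_eq_C_pow_mul h hL0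
  have hf : f ≠ 0 := ne_zero_of_constantCoeff_ne_zero hf0
  have hL : L ≠ 0 := ne_zero_of_constantCoeff_ne_zero hL0
  constructor
  · intro hspan
    obtain ⟨u, hu⟩ := Ideal.span_singleton_eq_span_singleton.mp hspan
    have hμu : mu (u : IwasawaAlgebra p) = 0 := ((isUnit_iff_mu_eq_zero_and_lam_eq_zero _).mp u.isUnit).2.1
    have hcu : IsUnit (PowerSeries.constantCoeff (u : IwasawaAlgebra p)) :=
      PowerSeries.isUnit_iff_constantCoeff.mp u.isUnit
    have hcu0 : PowerSeries.constantCoeff (u : IwasawaAlgebra p) ≠ 0 := hcu.ne_zero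
    have hvu : (PowerSeries.constantCoeff (u : IwasawaAlgebra p)).valuation = 0 :=
      (isUnit_iff_valuation_eq_zero hcu0).mp hcu
    refine ⟨?_, ?_⟩
    · have := mu_mul hf u.ne_zero
      rw [hu, hμu, add_zero] at this
      exact this.symm
    · have e := congrArg PowerSeries.constantCoeff hu
      rw [map_mul] at e
      rw [← e, PadicInt.valuation_mul hf0 hcu0, hvu, add_zero]
  · rintro ⟨hμ, hv⟩
    obtain ⟨c, hc⟩ := (dvd_iff_mu_le_and_valuation_le h hL0).mpr ⟨hμ.ge, by omega⟩
    have hc0 : c ≠ 0 := by rintro rfl; exact hf (by rw [hc, mul_zero])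
    have hlam : lam f = lam L := (lam_eq_lam_iff_valuation_le h hL0).mpr (by omega)
    have hunit : IsUnit c := by
      rw [isUnit_iff_mu_eq_zero_and_lam_eq_zero]
      have e1 := mu_mul hL hc0
      have e2 := lam_mul hL hc0
      rw [← hc] at e1 e2
      exact ⟨hc0, by omega, by omega⟩
    exact (span_eq_span_iff_isUnit hL hc).mpr hunit

/-- **`(f) = (L)` ⟺ `μ(f) ≤ μ(L)` and `ord_p L(0) ≤ ord_p f(0)`** (from `f·a = p^n·L`, `L(0) ≠ 0`):
the `μ`-inequality of Kato's direction plus the LOWER bound on the constant term of `f` pin the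
ideal — no `λ`. The reverse inequalities are automatic (`valuation_constantCoeff_add_mu_le`).
[cite: GreenbergVatsal2000, p. 4 (after Thm. (1.2))] [cite: Washington1997, §7.1] -/
theorem span_eq_span_iff_mu_le_and_valuation_le {f a L : IwasawaAlgebra p} {n : ℕ}
    (h : f * a = PowerSeries.C ((p : ℤ_[p]) ^ n) * L) (hL0 : PowerSeries.constantCoeff L ≠ 0) :
    Ideal.span ({f} : Set (IwasawaAlgebra p)) = Ideal.span {L} ↔
      mu f ≤ mu L ∧ (PowerSeries.constantCoeff L).valuation ≤ (PowerSeries.constantCoeff f).valuation := by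
  have hineq := valuation_constantCoeff_add_mu_le h hL0
  rw [span_eq_span_iff_mu_eq_and_valuation_eq h hL0]
  constructor
  · rintro ⟨hμ, hv⟩; exact ⟨hμ.le, hv.ge⟩
  · rintro ⟨hμ, hv⟩; exact ⟨by omega, by omega⟩

end Algebra

end Summit.BirchSwinnertonDyer.BirchSwinnertonDyer.Theorems.EisensteinShaCurrency

end
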